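import Mathlib
import HarnessLib
import Summits.ResolutionOfSingularities.ResolutionOfSingularities.Theorems.HomologicalConductorSurfaceTerminationRationalDescent
import Summits.ResolutionOfSingularities.ResolutionOfSingularities.Theorems.HomologicalConductorNoZenoCaInvertibleFourFacts

/-!
# Kill test `SurfaceTermination` (stmt-ResolutionOfSingularities-16488), LINE genus-descent: RATIONAL STAGES TERMINATE
# modulo FOUR prints (Görtz–Wedhorn 24.44 discharged, Lipman (12.1)(i) idle)

Route `ResolutionOfSingularities/HomologicalConductor` (cell decomp-res, hand leafhand-res-homologicalconduct-3 g1).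
OURS: AI-written, weaker than expert review; nothing here is a statement of the manuscript under review (Hironaka 2017).
SUPPORT level, counted 0.  Def-free, no new named facts.

The E-descent of record (`…SurfaceTerminationRationalDescent.rationalStageTermination`, K44S-DESCENT (R2): a stage with a RATIONAL
singularity is followed by a regular stage) and its registered text `stub_rationalStageTerminates` carry the six-fact bundle; the
bundle enters only through CAPTURE-PRINCIPAL (`RationalDescent.isPrincipal_map_ca_of_isRegularLocalRing_dominating`), whose one
Görtz–Wedhorn use is THEOREM A at a resolution of the two-dimensional stage — now `FourFacts.caInvertible_of_hasTrivialCechH1'`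
(`…NoZenoCaInvertibleFourFacts`, over the tree theorem `NoZeno.gwH2ResolutionDim2_holds`).  Twins (bodies verbatim, re-pointed):

* `RationalDescent.FourFacts.isPrincipal_map_ca_of_isRegularLocalRing_dominating4` — CAPTURE-PRINCIPAL modulo four prints;
* **`Descent.FourFacts.rationalStageTermination4`** — rational stages terminate, modulo {CJS 2020, Lipman (1.2), (4.1), (12.1)(ii)};
* `rationalStageTerminates_of_facts4` (the registered text of `stub_rationalStageTerminates` with the four-fact antecedent),
  `rationalPrimeDivisorSurfaceTermination4`, `surfaceTermination_of_hasRationalSingularity_zero4`.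

With `…GenusNonincreasingCJS` (genus monotonicity modulo CJS only) the genus-descent line's two fact-consuming engines are now
modulo FOUR prints; its research residue `stub_initialPairOfConstantGenus` is untouched.  No crux, kill test or summit statement
is proved; resolution of singularities in positive characteristic is NOT proved.
-/

noncomputable section

-- single-problem summit: the doubled namespace component `ResolutionOfSingularities` is forced
set_option linter.dupNamespace false

namespace Summit.ResolutionOfSingularities.ResolutionOfSingularities.Theorems.SurfaceTermination.RationalDescent.FourFacts

open CategoryTheory AlgebraicGeometry TopologicalSpace IsLocalRing
open Literature.RingTheory.CohomologyAnnihilator (cohomologyAnnihilator)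
open Literature.AlgebraicGeometry.Resolution Literature.AlgebraicGeometry.Morphisms
open Summit.ResolutionOfSingularities.ResolutionOfSingularities.Theorems
open Summit.ResolutionOfSingularities.ResolutionOfSingularities.Theorems.NoZeno.Birth
open Summit.ResolutionOfSingularities.ResolutionOfSingularities.Theorems.NoZeno.SandwichCluster

variable {k K : Type} [Field k] [Field K] [Algebra k K]

/-- **CAPTURE-PRINCIPAL modulo FOUR prints** (twin of `RationalDescent.isPrincipal_map_ca_of_isRegularLocalRing_dominating`):
for a singular rational stage `T_(n+1)` of a surface tower and a regular local `S ⊇ T_(n+1)` dominating it and essentially of finite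
type over `k`, `ca(T_(n+1))·S` is principal — minimal resolution (Lipman (4.1)) with `H¹ = 0` (Lipman (1.2)), THEOREM A mod (12.1)(ii)
(`FourFacts.caInvertible_of_hasTrivialCechH1'`), lifting (CJS) and the bridge.
[cite: Lipman1969, Theorem (4.1) (p. 204)] [cite: Lipman1969, Proposition (1.2) (p. 199)] -/
theorem isPrincipal_map_ca_of_isRegularLocalRing_dominating4
    (hF : (Literature.AlgebraicGeometry.Resolution.CossartJannsenSaito2020General.{0} ∧
      Literature.AlgebraicGeometry.Resolution.Lipman1969_1_2.{0} ∧
      Literature.AlgebraicGeometry.Resolution.Lipman1969_4_1.{0} ∧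
      Literature.AlgebraicGeometry.Resolution.Lipman1969_12_1_ii.{0}))
    (O : ValuationSubring K) (A : Subalgebra k K) (hk : ∀ c : k, algebraMap k K c ∈ O) (hA : A.FG)
    (hfr : IsFractionRing ↥A K) (hAO : A.toSubring ≤ O.toSubring) (htr : Algebra.trdeg k K = 2)
    (n : ℕ) (hsing : ¬ IsRegularLocalRing ↥(tower O A (n + 1)))
    (hrat : HasRationalSingularity ↥(tower O A (n + 1)))
    (S : Subalgebra k K) (hTS : tower O A (n + 1) ≤ S)
    (hdomS : ∀ t ∈ tower O A (n + 1), t⁻¹ ∈ S → t⁻¹ ∈ tower O A (n + 1))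
    (hSreg : IsRegularLocalRing ↥S) (hSeft : Algebra.EssFiniteType k ↥S) :
    (Ideal.map (Subalgebra.inclusion hTS).toRingHom (cohomologyAnnihilator ↥(tower O A (n + 1)))).IsPrincipal := by
  classical
  obtain ⟨hCJS, h12, h41, h121ii⟩ := hF
  obtain ⟨hTnoeth, hTnorm, hTfr, hTloc, hdimT, -⟩ := stage_package_of_trdeg O A hk hA hfr hAO htr n hsing
  haveI := hTnoeth; haveI := hTnorm; haveI := hTfr; haveI := hTloc; haveI := hSreg
  -- a minimal resolution of the rational stage, with `H¹ = 0`
  obtain ⟨X, π, hπ⟩ := h41.exists_isMinimalResolution_Spec ↥(tower O A (n + 1)) hdimT hrat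
  haveI : IsIntegral X := hπ.isResolution.isIntegral_source
  haveI : IsProper π := hπ.isResolution.isProper
  haveI : IsLocallyNoetherian X := AlgebraicGeometry.LocallyOfFiniteType.isLocallyNoetherian π
  have hH1 : HasTrivialCechH1 π := h12.hasTrivialCechH1_of_isResolution hdimT hrat π hπ.isResolution
  have hca : ∃ c : ℕ, maximalIdeal ↥(tower O A (n + 1)) ^ c ≤ cohomologyAnnihilator ↥(tower O A (n + 1)) :=
    exists_maximalIdeal_pow_le_cohomologyAnnihilator_tower O A hk hA hfr hAO htr n
  -- THEOREM A for the rational stage (res-D-pv-045), at every point of `π`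
  have hG : ∀ x : X, π x = closedPoint ↥(tower O A (n + 1)) →
      (Ideal.map (((X.presheaf.germ ⊤ x trivial).hom.comp
        (π.appTop.hom.comp (Scheme.ΓSpecIso (.of ↥(tower O A (n + 1)))).inv.hom)) :
          ↥(tower O A (n + 1)) →+* X.presheaf.stalk x)
        (cohomologyAnnihilator ↥(tower O A (n + 1)))).IsPrincipal :=
    fun x _ => FourFacts.caInvertible_of_hasTrivialCechH1' π h121ii hdimT hca hπ.isResolution hH1 x
  -- the lift and the bridge
  exact caPrincipal_of_invertible_of_lift (tower O A (n + 1)) S hTS hdomS π hG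
    (exists_lift_of_isRegularLocalRing_of_essFiniteType hCJS O A hk hA hfr hAO htr n hsing S hTS hSreg hSeft
      X π hπ)

end Summit.ResolutionOfSingularities.ResolutionOfSingularities.Theorems.SurfaceTermination.RationalDescent.FourFacts

namespace Summit.ResolutionOfSingularities.ResolutionOfSingularities.Theorems.SurfaceTermination.Descent.FourFacts

open CategoryTheory AlgebraicGeometry IsLocalRing
open Literature.AlgebraicGeometry.Resolution
open Literature.RingTheory.CohomologyAnnihilator (cohomologyAnnihilator)
open Summit.ResolutionOfSingularities.ResolutionOfSingularities.Theorems.NoZeno.Birth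
open Summit.ResolutionOfSingularities.ResolutionOfSingularities.Theorems.NoZeno.SandwichCluster
open Summit.ResolutionOfSingularities.ResolutionOfSingularities.Theorems.SurfaceTermination.Descent

variable {k K : Type} [Field k] [Field K] [Algebra k K]

/-- **RATIONAL STAGES TERMINATE, modulo FOUR prints** (twin of `Descent.rationalStageTermination`, K44S-DESCENT (R2); body verbatim,
CAPTURE-PRINCIPAL re-pointed to its four-fact twin): for the route's datum with `ringKrullDim A = 2` and any valuation ring `O ∋ k`,
if some stage `T_(m₁+1)` has a rational singularity, then some stage is a regular local ring.
[cite: Lipman1969, Proposition (1.2) and Theorem (4.1) (pp. 199, 204); ZariskiSamuel1960, Ch. VI §17] -/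
theorem rationalStageTermination4
    (hF : (CossartJannsenSaito2020General.{0} ∧ Lipman1969_1_2.{0} ∧ Lipman1969_4_1.{0} ∧
      Lipman1969_12_1_ii.{0}))
    (p : ℕ) (_hp : p.Prime) (k K : Type) [Field k] [CharP k p] [Field K] [Algebra k K]
    (O : ValuationSubring K) (A : Subalgebra k K) (hk : ∀ c : k, algebraMap k K c ∈ O) (hA : A.FG)
    (hfr : IsFractionRing ↥A K) (hAO : A.toSubring ≤ O.toSubring) (hdimA : ringKrullDim ↥A = 2)
    (m₁ : ℕ) (hrat₁ : HasRationalSingularity ↥(tower O A (m₁ + 1))) :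
    ∃ m : ℕ, IsRegularLocalRing ↥(tower O A m) := by
  classical
  haveI := hfr
  have h12 : Lipman1969_1_2.{0} := hF.2.1
  have htr : Algebra.trdeg k K = 2 := trdeg_eq_two_of_ringKrullDim A hA hfr hdimA
  -- wlog the rational stage is singular
  by_cases hreg₁ : IsRegularLocalRing ↥(tower O A (m₁ + 1))
  · exact ⟨_, hreg₁⟩
  -- abbreviations and the stage package at `m₁ + 1`
  have hmono : ∀ {i j : ℕ}, i ≤ j → tower O A i ≤ tower O A j :=
    fun hij _ hx => d2rc_mem_tower_of_le O A hij hx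
  have hTO : ∀ (j : ℕ) (t : K), t ∈ tower O A j → t ∈ O :=
    fun j t ht => mem_valuationSubring_of_mem_tower O hk hAO j t ht
  -- stages are dominated by `O`: an element of `T_j` inverted in `O` is inverted in `T_j` (`T_j = loc O B`)
  have inv_mem_tower_of_inv_mem : ∀ (j : ℕ) {t : K}, t ∈ tower O A j → t⁻¹ ∈ O → t⁻¹ ∈ tower O A j := by
    intro j t ht hti
    by_cases ht0 : t = 0
    · subst ht0; rw [inv_zero]; exact (tower O A j).zero_mem
    obtain ⟨B, hBO, hTB⟩ := exists_tower_eq_loc O A hk hAO j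
    have htO : t ∈ O := hTO j t ht
    rw [hTB, loc_eq_locAt] at ht ⊢
    exact SyzygyFlattening.inv_mem_locAt O B hBO ht
      (SyzygyFlattening.valuation_eq_one_of_inv_mem O htO hti ht0)
  haveI : IsNoetherianRing ↥(tower O A (m₁ + 1)) := stub_towerNoetherian k K O A hk hA hfr hAO _
  haveI : IsLocalRing ↥(tower O A (m₁ + 1)) := by
    obtain ⟨B, hBO, hTB⟩ := exists_tower_eq_loc O A hk hAO (m₁ + 1)
    rw [hTB, loc_eq_locAt]; exact SyzygyFlattening.isLocalRing_locAt O B hBO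
  have hdimT : ringKrullDim ↥(tower O A (m₁ + 1)) = 2 :=
    ringKrullDim_tower_eq_two_of_not_isRegularLocalRing O A hk hA hfr hAO htr m₁ hreg₁
  haveI : IsIntegrallyClosed ↥(tower O A (m₁ + 1)) := d2rc_isIntegrallyClosed_tower_succ O A hk hA hfr hAO m₁
  -- ONE resolution of the rational stage, fixed for the whole descent
  obtain ⟨X, π, hπ, -⟩ := id hrat₁
  haveI : IsProper π := hπ.isProper
  have hexcfin : (excCurvePoints π).Finite :=
    (excPoints_finite π).subset (hπ.excCurvePoints_subset_excPoints hdimT)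
  -- the centre-ring dictionary
  obtain ⟨ctr, hctrT, hctrReg, hctrInt, hctrEft, hcentre, hcurve⟩ :=
    CentreRing.exists_centreRing_tower O A hk hA hfr hAO htr m₁ hreg₁ X π hπ
  -- the measure
  let E : ℕ → Set (ValuationSubring K) := fun j =>
    {V | V ≠ ⊤ ∧ (tower O A j).toSubring ≤ V.toSubring ∧
      (∀ t ∈ tower O A j, t⁻¹ ∈ V → t⁻¹ ∈ tower O A j) ∧ ∃ x, ((ctr x : Set K) = (V : Set K))}
  have hE : ∀ j V, V ∈ E j ↔ (V ≠ ⊤ ∧ (tower O A j).toSubring ≤ V.toSubring ∧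
      (∀ t ∈ tower O A j, t⁻¹ ∈ V → t⁻¹ ∈ tower O A j) ∧ ∃ x, ((ctr x : Set K) = (V : Set K))) :=
    fun j V => Iff.rfl
  -- (F1) finiteness at `m₁ + 1`
  have hfin : (E (m₁ + 1)).Finite := by
    have himg : ((fun x => ((ctr x : Subalgebra k K) : Set K)) '' excCurvePoints π).Finite :=
      hexcfin.image _
    refine (himg.preimage (Set.injOn_of_injective SetLike.coe_injective)).subset ?_
    intro V hV
    obtain ⟨hVtop, -, hVdom, x, hx⟩ := (hE _ V).mp hV
    exact ⟨x, hcurve x V hVtop hVdom hx, hx⟩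
  -- (F2) antitone
  have hanti : ∀ j, E (j + 1) ⊆ E j := by
    intro j V hV
    obtain ⟨hVtop, hTV, hVdom, hx⟩ := (hE _ V).mp hV
    refine (hE _ V).mpr ⟨hVtop, fun t ht => hTV (Subalgebra.mem_toSubring.mpr (hmono (Nat.le_succ j) ht)),
      fun t ht hti => ?_, hx⟩
    have h1 : t⁻¹ ∈ tower O A (j + 1) := hVdom t (hmono (Nat.le_succ j) ht) hti
    exact inv_mem_tower_of_inv_mem j ht (hTO _ _ h1)
  -- singular stages below a singular stage; rationality along singular stages
  have hsing_of_le : ∀ {i j : ℕ}, i ≤ j → ¬ IsRegularLocalRing ↥(tower O A j) →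
      ¬ IsRegularLocalRing ↥(tower O A i) :=
    fun hij hj hi => hj (isRegularLocalRing_tower_of_le O A hk hfr hAO hij hi)
  have hrat_of : ∀ i, m₁ + 1 ≤ i → ¬ IsRegularLocalRing ↥(tower O A i) →
      HasRationalSingularity ↥(tower O A i) := by
    intro i hi
    induction i, hi using Nat.le_induction with
    | base => exact fun _ => hrat₁
    | succ i hi ih =>
      intro hsing'
      obtain ⟨n, rfl⟩ : ∃ n, i = n + 1 := ⟨i - 1, by omega⟩
      have hsing : ¬ IsRegularLocalRing ↥(tower O A (n + 1)) := hsing_of_le (Nat.le_succ _) hsing'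
      exact RationalDescent.hasRationalSingularity_tower_succ h12 O A hk hA hfr hAO htr n hsing (ih hsing)
  -- (F3) strictness at a singular step: the exit divisor is lost
  have hstrict : ∀ j, m₁ + 1 ≤ j → ¬ IsRegularLocalRing ↥(tower O A (j + 1)) →
      ∃ W ∈ E j, W ∉ E (j + 1) := by
    intro j hj hsingj
    obtain ⟨n, rfl⟩ : ∃ n, j = n + 1 := ⟨j - 1, by omega⟩
    obtain ⟨W, hWtop, -, hTW, hgen, hdomW, ⟨t₀, ht₀, ht₀i, ht₀n⟩, -⟩ :=
      exists_exitDivisor O A hk hA hfr hAO htr n hsingj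
    have hTW' : ∀ {i : ℕ}, i ≤ n + 1 + 1 → (tower O A i).toSubring ≤ W.toSubring :=
      fun hi t ht => hTW (Subalgebra.mem_toSubring.mpr (hmono hi ht))
    refine ⟨W, (hE _ W).mpr ⟨hWtop, hTW' (Nat.le_succ _), hdomW, ?_⟩,
      fun hW => ?_⟩
    swap
    · -- `W` does not dominate `T_(j+1)`
      obtain ⟨-, -, hdom', -⟩ := (hE _ W).mp hW
      exact ht₀n (hdom' t₀ ht₀ ht₀i)
    -- the centre ring `S` of `W` on `X`
    have hdom₁ : ∀ t ∈ tower O A (m₁ + 1), t⁻¹ ∈ W → t⁻¹ ∈ tower O A (m₁ + 1) := by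
      intro t ht hti
      have h1 : t⁻¹ ∈ tower O A (n + 1) := hdomW t (hmono hj ht) hti
      exact inv_mem_tower_of_inv_mem _ ht (hTO _ _ h1)
    obtain ⟨x, hxW, hxdom⟩ := hcentre W (hTW' (by omega)) hdom₁
    refine ⟨x, ?_⟩
    -- every stage up to `T_(j+1)` lies in `S := ctr x` (capture + step lemma, induction on the stage)
    have hstages : ∀ i, m₁ + 1 ≤ i → i ≤ n + 1 + 1 → tower O A i ≤ ctr x := by
      intro i hi
      induction i, hi using Nat.le_induction with
      | base => exact fun _ => hctrT x
      | succ i hi ih =>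
        intro hi'
        have hTS : tower O A i ≤ ctr x := ih (by omega)
        obtain ⟨d, rfl⟩ : ∃ d, i = d + 1 := ⟨i - 1, by omega⟩
        have hsingi : ¬ IsRegularLocalRing ↥(tower O A (d + 1)) := hsing_of_le (by omega) hsingj
        have hrati : HasRationalSingularity ↥(tower O A (d + 1)) := hrat_of (d + 1) hi hsingi
        -- `S` dominates `T_i`
        have hdomS : ∀ t ∈ tower O A (d + 1), t⁻¹ ∈ ctr x → t⁻¹ ∈ tower O A (d + 1) := by
          intro t ht hti
          have h1 : t⁻¹ ∈ tower O A (n + 1) :=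
            hdomW t (hmono (by omega) ht) (hxW (Subalgebra.mem_toSubring.mpr hti))
          exact inv_mem_tower_of_inv_mem _ ht (hTO _ _ h1)
        -- capture: `ca(T_i)·S` is principal
        have hprinc := RationalDescent.FourFacts.isPrincipal_map_ca_of_isRegularLocalRing_dominating4 hF O A hk hA hfr
          hAO htr d hsingi hrati (ctr x) hTS hdomS
          (hctrReg x) (hctrEft x)
        -- the step lemma with `V := W`
        exact SurfaceTermination.tower_succ_le_of_isPrincipal O A (d + 1) W.toSubring (hTW' hi') (ctr x) hTS hxW
          hxdom (hctrInt x) hprinc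
    have hTjS : tower O A (n + 1 + 1) ≤ ctr x := hstages (n + 1 + 1) (by omega) le_rfl
    -- `W ≤ S` (essential generation) and `S ≤ W`
    refine Set.Subset.antisymm (fun s hs => hxW (Subalgebra.mem_toSubring.mpr hs)) ?_
    intro w hw
    obtain ⟨a, ha, s, hs, hsi, rfl⟩ := hgen w hw
    exact (ctr x).mul_mem (hTjS ha) (hxdom s (hTjS hs) hsi)
  -- (F4) the descent
  have key : ∀ (c j : ℕ), m₁ + 1 ≤ j → (E j).Finite → (E j).ncard ≤ c →
      ∃ m : ℕ, IsRegularLocalRing ↥(tower O A m) := by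
    intro c
    induction c with
    | zero =>
      intro j hj hfinj hcard
      by_cases hreg : IsRegularLocalRing ↥(tower O A (j + 1))
      · exact ⟨_, hreg⟩
      obtain ⟨W, hW, -⟩ := hstrict j hj hreg
      have h0 : E j = ∅ := (Set.ncard_eq_zero hfinj).mp (Nat.le_zero.mp hcard)
      rw [h0] at hW
      exact absurd hW (Set.notMem_empty W)
    | succ c ih =>
      intro j hj hfinj hcard
      by_cases hreg : IsRegularLocalRing ↥(tower O A (j + 1))
      · exact ⟨_, hreg⟩
      obtain ⟨W, hWj, hWj1⟩ := hstrict j hj hreg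
      have hsub : E (j + 1) ⊆ E j := hanti j
      have hlt : (E (j + 1)).ncard < (E j).ncard :=
        Set.ncard_lt_ncard (Set.ssubset_iff_subset_ne.mpr ⟨hsub, fun h => hWj1 (h ▸ hWj)⟩) hfinj
      exact ih (j + 1) (by omega) (hfinj.subset hsub) (by omega)
  exact key _ (m₁ + 1) le_rfl hfin le_rfl

/-- **The registered kill-test stub text `stub_rationalStageTerminates` with the FOUR-fact antecedent**: rational stages terminate.
[cite: Lipman1969, Proposition (1.2) and Theorem (4.1) (pp. 199, 204)] -/
theorem rationalStageTerminates_of_facts4 :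
    (CossartJannsenSaito2020General.{0} ∧ Lipman1969_1_2.{0} ∧ Lipman1969_4_1.{0} ∧ Lipman1969_12_1_ii.{0}) →
    ∀ p : ℕ, p.Prime → ∀ (k K : Type) [Field k] [CharP k p] [Field K] [Algebra k K]
    (O : ValuationSubring K) (A : Subalgebra k K), (∀ c : k, algebraMap k K c ∈ O) → A.FG →
    IsFractionRing ↥A K → A.toSubring ≤ O.toSubring → ringKrullDim ↥A = 2 →
    ∀ m₁ : ℕ, HasRationalSingularity ↥(tower O A (m₁ + 1)) → ∃ m : ℕ, IsRegularLocalRing ↥(tower O A m) :=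
  fun hF p hp k K _ _ _ _ O A hk hA hfr hAO hdim m₁ hrat =>
    rationalStageTermination4 hF p hp k K O A hk hA hfr hAO hdim m₁ hrat

/-- **The rational sub-case of (D-s), modulo FOUR prints** (twin of `rationalPrimeDivisorSurfaceTermination`; the three prime-divisor
binders are inert). [cite: Lipman1969, Proposition (1.2) (p. 199)] -/
theorem rationalPrimeDivisorSurfaceTermination4
    (hF : (CossartJannsenSaito2020General.{0} ∧ Lipman1969_1_2.{0} ∧ Lipman1969_4_1.{0} ∧
      Lipman1969_12_1_ii.{0})) :
    ∀ p : ℕ, p.Prime → ∀ (k K : Type) [Field k] [CharP k p] [Field K] [Algebra k K]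
    (O : ValuationSubring K) (A : Subalgebra k K) (hk : ∀ c : k, algebraMap k K c ∈ O), A.FG →
    IsFractionRing ↥A K → A.toSubring ≤ O.toSubring → ringKrullDim ↥A = 2 → O ≠ ⊤ →
    IsDiscreteValuationRing ↥O → residueTrdeg k O hk + 1 = Algebra.trdeg k K →
    ∀ m₁ : ℕ, HasRationalSingularity ↥(tower O A (m₁ + 1)) → ∃ m : ℕ, IsRegularLocalRing ↥(tower O A m) :=
  fun p hp k K _ _ _ _ O A hk hA hfr hAO hdim _ _ _ m₁ hrat =>
    rationalStageTermination4 hF p hp k K O A hk hA hfr hAO hdim m₁ hrat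

/-- **`SurfaceTermination` for normal `A` with a rational singularity at the centre of `O`, modulo FOUR prints** (twin of
`surfaceTermination_of_hasRationalSingularity_zero`). [cite: Lipman1969, Proposition (1.2) (p. 199)] -/
theorem surfaceTermination_of_hasRationalSingularity_zero4
    (hF : (CossartJannsenSaito2020General.{0} ∧ Lipman1969_1_2.{0} ∧ Lipman1969_4_1.{0} ∧
      Lipman1969_12_1_ii.{0}))
    (p : ℕ) (hp : p.Prime) (k K : Type) [Field k] [CharP k p] [Field K] [Algebra k K]
    (O : ValuationSubring K) (A : Subalgebra k K) (hk : ∀ c : k, algebraMap k K c ∈ O) (hA : A.FG)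
    (hfr : IsFractionRing ↥A K) (hAO : A.toSubring ≤ O.toSubring) (hdimA : ringKrullDim ↥A = 2)
    [IsIntegrallyClosed ↥A] (hrat₀ : HasRationalSingularity ↥(tower O A 0)) :
    ∃ m : ℕ, IsRegularLocalRing ↥(tower O A m) :=
  rationalStageTermination4 hF p hp k K O A hk hA hfr hAO hdimA 0
    (RationalDescent.hasRationalSingularity_tower_one hF.2.1 O A hk hA hfr hAO
      (trdeg_eq_two_of_ringKrullDim A hA hfr hdimA) hrat₀)

end Summit.ResolutionOfSingularities.ResolutionOfSingularities.Theorems.SurfaceTermination.Descent.FourFacts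

end
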